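import Literature.MathematicalPhysics.QuantumFieldTheory.Balaban1983to89.B7Prop5General
import Literature.MathematicalPhysics.QuantumFieldTheory.Balaban1983to89.B9Ineq3137LocalSup

/-!
# `Balaban1983to89.B7Ineq146General` — T. Bałaban, *Averaging operations for lattice gauge theories*, Commun. Math. Phys. **98**
(1985) 17–51 [Balaban1985Averaging]: **(146) AT A GENERAL REGULAR BACKGROUND, FOR A GENERAL FIELD `A`** — «|Q_k(U₀)A| ≦ Q_k|A| +
2C′₁α₀Q″_k|A| ≦ (1 + 2C′₁α₀)Q″_k|A|», i.e. the composed linear part `LʲηQ_j(U₀)` (`B7Prop4GeneralLevels.linCovIter`) is bounded AT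
EVERY BOND `c` of the `j`-th lattice by `(1 + 2C′₁α₀)·Lʲ·L^{−jd}` times the ℓ¹-MASS of `A` over the bonds of `Bʲ(c₋) ∪ Bʲ(c₊)` —
the «per bond» kernel bound (147) of `B7Prop5General.prop5_general_147` SUMMED OVER THE KERNEL's SUPPORT

statement-level skeleton of published theorems with citation tags; proofs where landed; nothing here is a claim about the Yang–Mills mass gap

PDF held: `paper:balaban1985-cmp98-averaging` (journal page = PDF page + 16); p. 40 [PDF 24] ((146)–(147)), p. 39 [PDF 23] ((141)).

CITATION HEADER / WHAT IS REPRODUCED.  p. 40, verbatim: *"Thus finally we get |Q_k(U₀)A| ≦ Q_k|A| + 2C′₁α₀Q″_k|A| ≦ (1 +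
2C′₁α₀)Q″_k|A|, (146) or for the kernels |Q_k(U₀; c, b)| ≦ 1 + 2C′₁α₀. (147)"*; p. 39: *"(Q″_kA)_c = Σ_{b⊂Bᵏ(c₋)∪Bᵏ(c₊)} η^dA_b.
(141)"*.  The tree holds (147) PER BOND (`B7Prop5GeneralLinear.ineq147` ∕ `B7Prop5General.prop5_general_147`: the composed
linear part applied to a single-bond field `X·δ_b`, with its locality `linCovIter_bump_eq_zero`); THIS FILE sums it over the
bonds of `Bʲ(c₋) ∪ Bʲ(c₊)` — (146) for a GENERAL field `A`: the field is replaced on the box by the finite sum of its single-bond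
pieces (locality of the composed linear parts, `B9Ineq3137LocalSup.linCovIter_congr`), the composed linear part is additive in the
field at the level backgrounds (`B7Prop5GeneralLinear.linCovIter_line` fed by `B7Prop5GeneralLevels.hadd_levels`∕`hsmul_levels`),
and (147) bounds each piece.  Written for the T⁴ programme's row NE7 (cell `pub-balaban`, junction seat `b2b-balaban-t4-ne7b-p1`
gen 155): it is the «ℓ¹ → ℓ^∞» letter of the linear tower that turns the one-step remainder's LOCAL quadratic letter ([B7] (123),
`Spine/NE3/RemainderSumsStepB8.norm_Ccov_le_local_sq`) into a POINTWISE bound of the k-fold remainder by the field's ℓ²-mass.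

DICTIONARY (as in `B7Prop5General`): `θ = thetaGen d L α₀` (print's `2C′₁α₀`), `s_j = (Lʲ∕Lᵏ)²`; the regime (52) ↦ `pdev U₀ <
α₀L^{−2k}`, `U₀` valued in an `AvgClosed` structure group, `C₀α₀ ≤ 1∕3`, `4α₀ ≤ c₂′`, «16dC′₁L^{−4}α₀ ≦ 1» ↦ `h145`; the bonds
«b ⊂ Bʲ(c₋) ∪ Bʲ(c₊)» of `c = ⟨z, z + e_κ⟩` ↦ `B7Prop5Flat.bondsIn (loK L j z) (bondHiK L j z κ)`; `η^d` of (141) at level `j` ↦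
`((Lʲ)^d)⁻¹`, the un-normalisation `B = ηA` ↦ the factor `Lʲ` (as in (147) per bond).

WHAT THIS FILE PROVES (kernel, 0 sorry, standard axioms; theorems only): §1 `insCfg_eq_sum_bump` (a box insertion is the finite
sum of its single-bond fields); §2 `linCovIter_zero_field`, **`linCovIter_finset_sum`** (the composed linear part of a finite sum of
fields, `j ≤ k`); §3 **`ineq146_general`** — for `j ≤ k`, every field `A` and every bond `c = ⟨z, z + e_κ⟩` of the `j`-th lattice,
`‖LʲηQ_j(U₀)A(c)‖ ≤ (1 + θs_j)·Lʲ·(Lʲ)^{−d}·Σ_{b ⊂ Bʲ(c₋)∪Bʲ(c₊)} ‖A_b‖`, and the k-uniform form **`ineq146_general_uniform`**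
(`s_j ≤ 1`).  DIVERGENCES from print: as in `B7Prop5General` (constants admissible, not optimal; `ℤᵈ`, corner blocks,
`U1`∕`AvgClosed` background); the right-hand side is the ℓ¹-mass over the two-block (print's `(1 + 2C′₁α₀)Q″_k|A|` read with (141)),
no supremum is taken.
-/

noncomputable section

open scoped BigOperators
open NormedSpace Finset

namespace Literature.MathematicalPhysics.QuantumFieldTheory.Balaban1983to89.B7Ineq146General

open B7Prop1Explicit B7Prop1Local B7Prop2Explicit B7Prop3Flat B7Prop3GeneralLinear B7Prop4GeneralLevels
  B7Prop5GeneralOperators B7Prop5GeneralLinear B7Prop5GeneralLevels B7Prop5General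
open B7Prop5Flat (BondIn bump bondsIn mem_bondsIn restr insCfg_restr_of_mem agreeOn_insCfg_restr)
open B9Ineq3137LocalSup (linCovIter_congr)

-- `Site` alone would resolve to the torus sites of `Setup.lean`; re-export the `ℤ^d` sites of `B7Prop1Explicit`.
export B7Prop1Explicit (Site)

variable {d : ℕ}

variable {𝔸 : Type*} [NormedRing 𝔸] [NormedAlgebra ℂ 𝔸] [CompleteSpace 𝔸] [NormOneClass 𝔸]

/-! ## §1 A box insertion is the finite sum of its single-bond fields -/

omit [NormedAlgebra ℂ 𝔸] [CompleteSpace 𝔸] [NormOneClass 𝔸] in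
/-- `insCfg S a = Σ_{s ∈ S} (a s)·δ_s`: the insertion of the box variables is the sum of the single-bond fields (138).
[cite: Balaban1985Averaging, (137)–(138) p.39] -/
theorem insCfg_eq_sum_bump (S : Finset (Site d × Fin d)) (a : S → 𝔸) :
    insCfg S a = ∑ s ∈ S.attach, bump s.1.1 s.1.2 (a s) := by
  funext x κ
  rw [Finset.sum_apply, Finset.sum_apply]
  by_cases h : (x, κ) ∈ S
  · rw [Finset.sum_eq_single ⟨(x, κ), h⟩]
    · simp [insCfg, bump, h]
    · intro s _ hs
      apply B7Prop5Flat.bump_eq_zero_of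
      rintro ⟨rfl, rfl⟩
      exact hs (Subtype.ext rfl)
    · intro hs; exact absurd (Finset.mem_attach _ _) hs
  · have h0 : ∀ s ∈ S.attach, bump s.1.1 s.1.2 (a s) x κ = 0 := by
      intro s _
      apply B7Prop5Flat.bump_eq_zero_of
      rintro ⟨h1, h2⟩
      apply h
      have : (x, κ) = s.1 := Prod.ext h1 h2
      rw [this]; exact s.2
    rw [Finset.sum_eq_zero h0]
    simp [insCfg, h]

/-! ## §2 The composed linear part of a finite sum of fields -/

section Regime

variable (L : ℕ) (hL : 2 ≤ L) {G : Subgroup 𝔸ˣ} (hG : AvgClosed d L G) (k : ℕ)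
  (U₀ : Site d → Fin d → 𝔸ˣ) (hU₀ : ∀ x κ, U₀ x κ ∈ G) {α₀ : ℝ} (hα : 0 < α₀)
  (hα3 : C0 d * α₀ ≤ 1 / 3) (hα4 : 4 * α₀ ≤ c2' d L) (h52 : pdev U₀ < α₀ * (((L : ℝ) ^ k)⁻¹) ^ 2)

include hL hG hU₀ hα hα3 hα4 h52 in
/-- the composed linear part of the ZERO field vanishes (`j ≤ k`). [cite: Balaban1985Averaging, p.38 (before (133)), (122) p.36] -/
theorem linCovIter_zero_field {j : ℕ} (hj : j ≤ k) (x : Site d) (κ : Fin d) :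
    linCovIter L U₀ (0 : Site d → Fin d → 𝔸) j x κ = 0 := by
  have h := linCovIter_line L U₀ k (hadd_levels L hL hG k U₀ hU₀ hα hα3 hα4 h52)
    (hsmul_levels L hL hG k U₀ hU₀ hα hα3 hα4 h52) (0 : Site d → Fin d → 𝔸) 0 j hj (1 : ℂ) x κ
  rw [one_smul, one_smul, add_zero] at h
  -- `a = a + a` forces `a = 0`
  have : linCovIter L U₀ (0 : Site d → Fin d → 𝔸) j x κ + linCovIter L U₀ (0 : Site d → Fin d → 𝔸) j x κ
      = linCovIter L U₀ (0 : Site d → Fin d → 𝔸) j x κ + 0 := by rw [add_zero]; exact h.symm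
  exact add_left_cancel this

include hL hG hU₀ hα hα3 hα4 h52 in
/-- **ADDITIVITY OVER FINITE SUMS**: `LʲηQ_j(U₀)(Σ_i F_i)(c) = Σ_i LʲηQ_j(U₀)F_i(c)` for `j ≤ k` (every factor «Q(Ū₀ⁱ)» of
«Q_j(U₀) = Q(Ū₀^{j−1})⋯Q(U₀)» is additive and homogeneous at the level backgrounds — `B7Prop5GeneralLevels.hadd_levels`,
`hsmul_levels` — through `B7Prop5GeneralLinear.linCovIter_line`). [cite: Balaban1985Averaging, p.38 (before (133)), (122) p.36] -/
theorem linCovIter_finset_sum {ι : Type*} (T : Finset ι) (F : ι → Site d → Fin d → 𝔸) {j : ℕ} (hj : j ≤ k)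
    (x : Site d) (κ : Fin d) :
    linCovIter L U₀ (∑ i ∈ T, F i) j x κ = ∑ i ∈ T, linCovIter L U₀ (F i) j x κ := by
  classical
  induction T using Finset.induction_on with
  | empty =>
    rw [Finset.sum_empty, Finset.sum_empty]
    exact linCovIter_zero_field L hL hG k U₀ hU₀ hα hα3 hα4 h52 hj x κ
  | insert i T hi ih =>
    rw [Finset.sum_insert hi, Finset.sum_insert hi, add_comm (F i)]
    have h := linCovIter_line L U₀ k (hadd_levels L hL hG k U₀ hU₀ hα hα3 hα4 h52)
      (hsmul_levels L hL hG k U₀ hU₀ hα hα3 hα4 h52) (∑ i ∈ T, F i) (F i) j hj (1 : ℂ) x κ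
    rw [one_smul, one_smul] at h
    rw [h, ih, add_comm]

/-! ## §3 (146) for a general field: the two-block ℓ¹-mass bound of the composed linear part -/

include hL hG hU₀ hα hα3 hα4 h52 in
/-- **(146) AT A GENERAL BACKGROUND, GENERAL FIELD, PER LEVEL `j ≤ k`** «|Q_k(U₀)A| ≦ (1 + 2C′₁α₀)Q″_k|A|»: for every field `A`
and every bond `c = ⟨z, z + e_κ⟩` of the `j`-th lattice,
`‖LʲηQ_j(U₀)A(c)‖ ≤ (1 + θ(Lʲ∕Lᵏ)²)·Lʲ·(Lʲ)^{−d}·Σ_{b ⊂ Bʲ(c₋) ∪ Bʲ(c₊)} ‖A_b‖` (`θ = thetaGen d L α₀` = print's `2C′₁α₀`; under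
«16dC′₁L^{−4}α₀ ≦ 1» = `h145`).  Proof: replace `A` on the box by `Σ_b A_b·δ_b` (locality `B9Ineq3137LocalSup.linCovIter_congr`),
expand by `linCovIter_finset_sum`, bound each term by (147) (`B7Prop5General.prop5_general_147`). [cite: Balaban1985Averaging, (146)–(147) p.40, (141) p.39] -/
theorem ineq146_general (h145 : 8 * d * thetaGen d L α₀ * (L : ℝ)⁻¹ ^ 4 ≤ 1) (A : Site d → Fin d → 𝔸)
    {j : ℕ} (hj : j ≤ k) (z : Site d) (κ : Fin d) :
    ‖linCovIter L U₀ A j z κ‖ ≤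
      (1 + thetaGen d L α₀ * ((L : ℝ) ^ j * ((L : ℝ) ^ k)⁻¹) ^ 2) * ((L : ℝ) ^ j * (((L : ℝ) ^ j) ^ d)⁻¹)
        * ∑ b ∈ bondsIn (loK L j z) (bondHiK L j z κ), ‖A b.1 b.2‖ := by
  classical
  have hL1 : 1 ≤ L := le_trans (by norm_num) hL
  set S : Finset (Site d × Fin d) := bondsIn (loK L j z) (bondHiK L j z κ) with hS
  -- replace `A` by its box insertion (locality of the composed linear parts)
  have hagree : AgreeOn (loK L j z) (bondHiK L j z κ) A (insCfg S (restr S A)) := agreeOn_insCfg_restr _ _ A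
  have hloc : linCovIter L U₀ A j z κ = linCovIter L U₀ (insCfg S (restr S A)) j z κ :=
    linCovIter_congr L hL1 j z κ (fun _ _ _ _ => rfl) hagree
  rw [hloc, insCfg_eq_sum_bump, linCovIter_finset_sum L hL hG k U₀ hU₀ hα hα3 hα4 h52 _ _ hj]
  -- bound each single-bond term by (147)
  set K : ℝ := (1 + thetaGen d L α₀ * ((L : ℝ) ^ j * ((L : ℝ) ^ k)⁻¹) ^ 2) * ((L : ℝ) ^ j * (((L : ℝ) ^ j) ^ d)⁻¹) with hK
  have hterm : ∀ s ∈ S.attach, ‖linCovIter L U₀ (bump s.1.1 s.1.2 (restr S A s)) j z κ‖ ≤ K * ‖A s.1.1 s.1.2‖ := by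
    intro s _
    have h := (prop5_general_147 L hL hG k U₀ hU₀ hα hα3 hα4 h52 h145 s.1.1 s.1.2 (restr S A s) hj z κ).1
    simpa [restr, hK] using h
  calc ‖∑ s ∈ S.attach, linCovIter L U₀ (bump s.1.1 s.1.2 (restr S A s)) j z κ‖
      ≤ ∑ s ∈ S.attach, ‖linCovIter L U₀ (bump s.1.1 s.1.2 (restr S A s)) j z κ‖ := norm_sum_le _ _
    _ ≤ ∑ s ∈ S.attach, K * ‖A s.1.1 s.1.2‖ := Finset.sum_le_sum hterm
    _ = K * ∑ s ∈ S.attach, ‖A s.1.1 s.1.2‖ := by rw [Finset.mul_sum]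
    _ = K * ∑ b ∈ S, ‖A b.1 b.2‖ := by rw [Finset.sum_attach S (fun b => ‖A b.1 b.2‖)]

include hL hG hU₀ hα hα3 hα4 h52 in
/-- **(146), k-UNIFORM FORM** «|Q_k(U₀; c, b)| ≦ 1 + 2C′₁α₀» summed over `b`: since `(Lʲ∕Lᵏ)² ≤ 1` for `j ≤ k`,
`‖LʲηQ_j(U₀)A(c)‖ ≤ (1 + θ)·Lʲ·(Lʲ)^{−d}·Σ_{b ⊂ Bʲ(c₋) ∪ Bʲ(c₊)} ‖A_b‖`. [cite: Balaban1985Averaging, (146)–(147) p.40] -/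
theorem ineq146_general_uniform (h145 : 8 * d * thetaGen d L α₀ * (L : ℝ)⁻¹ ^ 4 ≤ 1) (A : Site d → Fin d → 𝔸)
    {j : ℕ} (hj : j ≤ k) (z : Site d) (κ : Fin d) :
    ‖linCovIter L U₀ A j z κ‖ ≤
      (1 + thetaGen d L α₀) * ((L : ℝ) ^ j * (((L : ℝ) ^ j) ^ d)⁻¹)
        * ∑ b ∈ bondsIn (loK L j z) (bondHiK L j z κ), ‖A b.1 b.2‖ := by
  have h := ineq146_general L hL hG k U₀ hU₀ hα hα3 hα4 h52 h145 A hj z κ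
  refine h.trans (mul_le_mul_of_nonneg_right (mul_le_mul_of_nonneg_right ?_ (by positivity)) ?_)
  · have hθ : 0 ≤ thetaGen d L α₀ := by unfold thetaGen; positivity
    have hL1r : (1 : ℝ) ≤ L := by exact_mod_cast le_trans (by norm_num) hL
    have hLk : (0 : ℝ) < (L : ℝ) ^ k := by positivity
    have hratio : (L : ℝ) ^ j * ((L : ℝ) ^ k)⁻¹ ≤ 1 := by
      rw [mul_inv_le_iff₀ hLk, one_mul]; exact pow_le_pow_right₀ hL1r hj
    have h1 : ((L : ℝ) ^ j * ((L : ℝ) ^ k)⁻¹) ^ 2 ≤ 1 := by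
      rw [← one_pow 2]; exact pow_le_pow_left₀ (by positivity) hratio 2
    nlinarith
  · exact Finset.sum_nonneg fun b _ => norm_nonneg _

end Regime

end Literature.MathematicalPhysics.QuantumFieldTheory.Balaban1983to89.B7Ineq146General

end
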